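import Literature.Analysis.FluidPDE.SelfSimilarEulerPressureShellBound
import Literature.Analysis.FluidPDE.SelfSimilarEulerEnergyBootstrap
import HarnessLib

/-!
# Bronzi–Shvydkoy 2015, Theorem 1.1: the named fact `bronziShvydkoy2015_energy_dichotomy` holds

Analysis/FluidPDE proof file (theorems only; no definitions, no named facts, no `sorry`): the
discharge `bronziShvydkoy2015_energy_dichotomy_holds` of the NAMED FACT of
`SelfSimilarEulerEnergyConcentration.lean` — A. Bronzi, R. Shvydkoy, *On the energy behavior of
locally self-similar blowup for the Euler equation*, Indiana Univ. Math. J. **64** (2015) 1291–1302 =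
arXiv:1310.8611 [BronziShvydkoy2015], **Theorem 1.1** (`N = 3`, Beale–Kato–Majda class):

> "Suppose `u ∈ C([0,T), H^s(ℝ^N))` is a solution to (EE) locally self-similar in a ball
> `B_{ρ₀}(x₀)` with profile `v ∈ C³_loc(ℝ^N)` and scaling `0 < α < N/2`. Suppose further that for
> some `p ≥ 3` and `γ < p − 2`, `∫_{|y|∼L} |v(y)|^p dy ≲ L^γ`, for large `L`. Then either `v = 0` or
> one has `L^{N−2α} ≲ ∫_{|y|<L} |v(y)|² dy ≲ L^{N−2α}`."

The printed proof, assembled from the tree: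
* (1.5)–(1.6) the energy growth `∫_{|y|<L}|v|² ≤ ‖u(0)‖₂² ρ₀^{2α−3} L^{3−2α}` from the conserved
  (non-increasing) energy of the ambient solution — `energyGrowth_of_locallySelfSimilar`
  (`SelfSimilarEulerPressureRecovery.lean`); whence the far weight `|v|²/|z|³` is integrable near
  infinity (§2 Step 1, `BronziShvydkoy2015.farWeight_integrableOn_and_le`);
* Lemma 2.1: a pressure profile `P` solving (2.3) with `v` and obeying the dyadic law (2.4) —
  `BronziShvydkoy2015.exists_pressureProfile_shell_bound` (`SelfSimilarEulerPressureShellBound.lean`);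
* §3 (reversed two-scale inequality, interpolation, Claim 3.1) —
  `IsSelfSimilarEulerProfile.energy_dichotomy_of_shellGrowth_of_pressureLaw`
  (`SelfSimilarEulerEnergyBootstrap.lean`).

The shell-growth constant `C` of the fact's hypothesis is replaced by `max C 0` on `L ≥ max L₀ 1`
(harmless: the shell integrals are non-negative and `L^γ > 0` there).  With this discharge the
general-class Remarks 1.2–1.4 of `SelfSimilarEulerEnergyDichotomyRemarks.lean` (stated relative to
the fact) become unconditional by applying them to `bronziShvydkoy2015_energy_dichotomy_holds`.

## Mathlib / tree search

`lean search 'bronziShvydkoy2015_energy_dichotomy_holds'`: absent before this file (MAP v16 §3b: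
"FACT"). Everything used is cited above by name. No new definitions, no instances, no notation.
-/

noncomputable section

open MeasureTheory Set Filter Topology Metric
open scoped ENNReal NNReal

namespace Literature.Analysis.FluidPDE

/-! ## The named fact, discharged -/

namespace BronziShvydkoy2015

/-- The far weight of a continuous field, integrable beyond some radius `R₀ ≥ 1`, is integrable on
`{|z| ≥ 1}` (the annulus `1 ≤ |z| ≤ R₀` is compact and avoids the origin). [folklore] -/
private theorem integrableOn_far_weight_one {v : EuclideanSpace ℝ (Fin 3) → EuclideanSpace ℝ (Fin 3)}
    (hv : Continuous v) {R₀ : ℝ}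
    (hfar : IntegrableOn (fun z => ‖v z‖ ^ 2 / ‖z‖ ^ 3) {z : EuclideanSpace ℝ (Fin 3) | R₀ ≤ ‖z‖} volume) :
    IntegrableOn (fun z => ‖v z‖ ^ 2 / ‖z‖ ^ 3) {z : EuclideanSpace ℝ (Fin 3) | 1 ≤ ‖z‖} volume := by
  have hK : IsCompact {z : EuclideanSpace ℝ (Fin 3) | 1 ≤ ‖z‖ ∧ ‖z‖ ≤ R₀} := by
    refine (isCompact_closedBall (0 : EuclideanSpace ℝ (Fin 3)) R₀).of_isClosed_subset
      ((isClosed_le continuous_const continuous_norm).inter (isClosed_le continuous_norm continuous_const))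
      fun z hz => ?_
    rw [mem_closedBall_zero_iff]; exact hz.2
  have hcont : ContinuousOn (fun z : EuclideanSpace ℝ (Fin 3) => ‖v z‖ ^ 2 / ‖z‖ ^ 3)
      {z | 1 ≤ ‖z‖ ∧ ‖z‖ ≤ R₀} := by
    refine ((hv.norm.pow 2).continuousOn).div (continuous_norm.pow 3).continuousOn fun z hz => ?_
    exact (pow_pos (zero_lt_one.trans_le hz.1) 3).ne'
  refine ((hcont.integrableOn_compact hK).union hfar).mono_set fun z hz => ?_
  by_cases h : ‖z‖ ≤ R₀
  · exact Or.inl ⟨hz, h⟩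
  · exact Or.inr (le_of_lt (not_le.1 h))

end BronziShvydkoy2015

/-- **Bronzi–Shvydkoy 2015, Theorem 1.1 — the named fact `bronziShvydkoy2015_energy_dichotomy`
DISCHARGED.**  For a classical Euler solution on `ℝ³ × [0,T)` in the Beale–Kato–Majda class that is
locally self-similar on `B_{ρ₀}(x₀)` with a `C³` profile `v` and scaling `0 < α < 3/2`, under the
shell growth `∫_{L<|y|<2L}|v|^r ≲ L^γ` (`r ≥ 3`, `γ < r − 2`): either `v = 0` or
`c L^{3−2α} ≤ ∫_{|y|<L}|v|² ≤ C L^{3−2α}` for all large `L`.  Assembly of the printed proof: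
(1.6) `energyGrowth_of_locallySelfSimilar` (SelfSimilarEulerPressureRecovery) + Lemma 2.1
`BronziShvydkoy2015.exists_pressureProfile_shell_bound` (SelfSimilarEulerPressureShellBound) + §3
`IsSelfSimilarEulerProfile.energy_dichotomy_of_shellGrowth_of_pressureLaw`
(SelfSimilarEulerEnergyBootstrap). [cite: BronziShvydkoy2015, §1 Thm. 1.1] -/
theorem bronziShvydkoy2015_energy_dichotomy_holds : bronziShvydkoy2015_energy_dichotomy := by
  intro T α ρ₀ x₀ u p v hT hα hα2 hρ₀ hsol hreg hv hss hshell
  -- the exponent `γ' = 1/(α+1) ∈ (0,1)`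
  have hα1 : -1 < α := by linarith
  have hγ0 : 0 < 1 / (α + 1) := by positivity
  have hγ1 : 1 / (α + 1) < 1 := by rw [div_lt_one (by linarith)]; linarith
  have hvc : Continuous v := hv.continuous
  -- (1.6): the energy growth, for `L ≥ L_E := max (ρ₀ T^{−γ'}) 1`
  set E₀ : ℝ := ∫ x, ‖u 0 x‖ ^ 2 with hE₀
  have hE₀0 : 0 ≤ E₀ := integral_nonneg fun _ => sq_nonneg _
  set C_E : ℝ := E₀ * ρ₀ ^ (2 * α - 3) with hCE
  have hCE0 : 0 ≤ C_E := by positivity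
  set L_E : ℝ := max (ρ₀ * T ^ (-(1 / (α + 1)))) 1 with hLE
  have hLE0 : 0 < L_E := lt_max_of_lt_right one_pos
  have hE : ∀ L : ℝ, L_E ≤ L →
      ∫ y in ball (0 : EuclideanSpace ℝ (Fin 3)) L, ‖v y‖ ^ 2 ≤ C_E * L ^ (3 - 2 * α) :=
    fun L hL => energyGrowth_of_locallySelfSimilar hT hα1 hρ₀ hsol hreg hss ((le_max_left _ _).trans hL)
  -- the far weight near infinity (BS15 §2 Step 1)
  have hfarE := (BronziShvydkoy2015.farWeight_integrableOn_and_le hvc (a := 2 * α) (by linarith) hCE0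
    hLE0 (fun L hL => by have := hE L hL; ring_nf at this ⊢; exact this) (R := L_E) le_rfl).1
  have hfar : IntegrableOn (fun z => ‖v z‖ ^ 2 / ‖z‖ ^ 3) {z : EuclideanSpace ℝ (Fin 3) | 1 ≤ ‖z‖} volume :=
    BronziShvydkoy2015.integrableOn_far_weight_one hvc hfarE
  -- Lemma 2.1: a profile pressure with the dyadic law (2.4)
  obtain ⟨K, hK0, hK⟩ := BronziShvydkoy2015.exists_pressureProfile_shell_bound
  obtain ⟨P, hP, hPl⟩ := hK T (1 / (α + 1)) ρ₀ x₀ u p v hT hγ0 hγ1 hρ₀ hsol hreg (hv.of_le (by norm_num))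
    hss hfar
  -- the shell growth (1.7), with a non-negative constant
  obtain ⟨r, γ, C, L₀, hr, hγr, hS⟩ := hshell
  have hS' : ∀ L : ℝ, max L₀ 1 ≤ L →
      ∫ y in {y : EuclideanSpace ℝ (Fin 3) | L < ‖y‖ ∧ ‖y‖ < 2 * L}, ‖v y‖ ^ r ≤ max C 0 * L ^ γ := by
    intro L hL
    have hL0 : 0 < L := one_pos.trans_le ((le_max_right _ _).trans hL)
    exact (hS L ((le_max_left _ _).trans hL)).trans
      (mul_le_mul_of_nonneg_right (le_max_left _ _) (Real.rpow_nonneg hL0.le _))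
  -- §3: the dichotomy
  exact hP.energy_dichotomy_of_shellGrowth_of_pressureLaw hα hα2 hCE0 hLE0 hE hr hγr (le_max_right _ _)
    hS' hK0 (L₃ := 1) (fun L hL => hPl L (by linarith))



end Literature.Analysis.FluidPDE
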